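import Summits.QuantumFields.YangMills.Theorems.BalabanUVNodesN15TorusReflections
import Summits.QuantumFields.YangMills.Theorems.BalabanUVNodesN15TwoGridStability
import HarnessLib

/-!
# Route «BalabanUVNodes» (K3⁷), node N15 = NE2, -a lane, PROGRAMME N file N-Ib: REFLECTION EQUIVARIANCE OF BAŁABAN's LANDAU-GAUGE OPERATOR
# `Δ_a = Δ − ∂P∂* + aQ*Q` ([B5] (1.69)∕(1.73)) AND OF ITS INVERSE `G = Δ_a⁻¹` AT `U ≡ 1` ON THE TORUS `T_η`

Cell `pub-ymgap`, seat `pub-ymgap-dag-n15-a` (KNIT-BY-NAME, g19; D-0062; chair R424 venue; `bears_on: R4∕N15`); `--kind proof --supports stmt-QuantumFields-20544 --as helper`.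
Sequel of N-Ia `…N15TorusReflections` (point reflection `torRefl`, operators `reflS`∕`reflV`∕their real forms); consumer: N-III (the Neumann-by-images cube propagator of
[Balaban1984PropagatorsII] (2.37) «e.g. with Neumann boundary conditions as in [3]» for dag-n15-c's two-spacing gluing `…N15TwoSpacingGluing*`, pub-ymgap INBOX l.27050).

WHAT.  §3 EQUIVARIANCE of the b05 position-space letters under the block-face reflection `σ_κ`: `LapS` (scalar Laplacian (1.21)), ★ `GradOp` (`R¹∂ = ∂R⁰` — the bond
twist), `LapV`∕`Lap` (vector Laplacian), `Pker` and `LapSinv` (the pseudo-inverse of `Δ`, by the algebra `Δ⁻¹Δ + Π₀ = 1`, `Π₀Δ⁻¹ = 0 = Δ⁻¹Π₀` — no Fourier transform),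
`QsOp` ((1.20): blocks go to blocks), ★★ `QvOp` (Bałaban's vector average (1.18): the line-count stencil of a reversed coarse bond is enumerated by `j_κ ↦ n−1−j_κ`,
`t ↦ n−1−t`), `QvAdj`, `Mop = Q′Δ⁻²Q′*`, `Cavg`, `Kmat`, `Minv`, `PcT` (1.26)∕(1.70), ★★ `DeltaA` (1.69)∕(1.73), ★★ `(DeltaA)⁻¹` (1.71), `DeltaAR`, `GR`.  §4 the reflections as
REAL linear maps `reflVR M n κ` ∕ `reflSR κ N` (apply lemmas, involutivity) and ★★★ `reflVR_comp_deltaOp`, ★★★ `reflVR_comp_gOp` (`R_κ ∘ G = G ∘ R_κ` for this lineage's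
`gOp M n a = Δ_a⁻¹` on real 1-forms, `n ≥ 1`, `a > 0`), `reflVR_comp_gOp_comp_reflVR`.
HONEST FRAMING.  Finite-dimensional lattice algebra (index bijections on finite tori and the resolvent identity `RA = AR ⇒ RA⁻¹ = A⁻¹R`); no estimate; `U ≡ 1` torus MODEL of
[B5] §1; nothing of [B6]∕[B9] asserted; N15 NOT discharged (object-bound; NE2⁺ NOT PRINTED); counts UNMOVED (typed 28∕28 · discharged 5∕27); one finite torus at fixed lattice
spacing — NOT continuum ∕ ℝ⁴ ∕ OS ∕ mass gap ∕ Clay.  Plumbing defs are DATA (two real linear maps); every theorem is [folklore] lattice algebra about printed objects.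
-/

noncomputable section

open scoped BigOperators Matrix ComplexConjugate
open Finset

namespace Summit.QuantumFields.YangMills.BalabanUVNodes.N15.TwoGrid

open Literature.MathematicalPhysics.QuantumFieldTheory.Balaban1983to89
open Literature.MathematicalPhysics.QuantumFieldTheory.Balaban1983to89.B5Prop11Plancherel (Tor fine unitVec shiftM fdiff)
open Literature.MathematicalPhysics.QuantumFieldTheory.Balaban1983to89.B5Block118 (tstep up upHom iota bpt lineSum QsOp QvOp QsOp_mulVec QvOp_mulVec tstep_succ)
open Literature.MathematicalPhysics.QuantumFieldTheory.Balaban1983to89.B5Action121 (shiftS sdiff sdiff_mulVec GradOp GradOp_mulVec LapS LapS_mulVec LapV)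
open Literature.MathematicalPhysics.QuantumFieldTheory.Balaban1983to89.B5Prop11Lower (Lap)
open Literature.MathematicalPhysics.QuantumFieldTheory.Balaban1983to89.B5LaplaceInverse (LapSinv Pker LapS_mul_LapSinv LapSinv_mul_LapS LapSinv_mul_Pker
  Pker_mul_LapSinv Pker_const Pker_orth)
open Literature.MathematicalPhysics.QuantumFieldTheory.Balaban1983to89.B5Substitution125 (Mop Cavg Kmat Minv Kmat_isUnit)
open Literature.MathematicalPhysics.QuantumFieldTheory.Balaban1983to89.B5Projection127 (Pc)
open Literature.MathematicalPhysics.QuantumFieldTheory.Balaban1983to89.B5Value126 (PcT)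
open Literature.MathematicalPhysics.QuantumFieldTheory.Balaban1983to89.B5DeltaA169 (DeltaA QvAdj isUnit_DeltaA)
open Literature.MathematicalPhysics.QuantumFieldTheory.Balaban1983to89.B5RealFields (IsReal reM GR DeltaAR isReal_DeltaA)

variable {d : ℕ}

/-! ## §3 Equivariance of the b05 letters -/

section Scalar

variable (N : Fin d → ℕ) [∀ μ, NeZero (N μ)] (κ : Fin d) (c : ℂ)

/-- `R⁰Δ = ΔR⁰` for the scalar Laplacian (the stencil `2f(x) − f(x+e_ν) − f(x−e_ν)` is mirror symmetric). [cite: Balaban1984PropagatorsI, (1.21) p.21] -/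
theorem reflS_mul_LapS : reflS N κ * LapS N c = LapS N c * reflS N κ := by
  refine matrix_eq_of_mulVec_eq fun f => ?_
  funext x
  rw [← Matrix.mulVec_mulVec, ← Matrix.mulVec_mulVec, reflS_mulVec, LapS_mulVec, LapS_mulVec]
  refine Finset.sum_congr rfl fun ν _ => ?_
  simp only [reflS_mulVec]
  by_cases h : ν = κ
  · subst h; rw [torRefl_add_unitVec_same, torRefl_sub_unitVec_same]; ring
  · rw [torRefl_add_unitVec_ne _ h, torRefl_sub_unitVec_ne _ h]

/-- ★ **THE BOND TWIST**: `R¹∂ = ∂R⁰`. [cite: Balaban1984PropagatorsI, (1.4) p.18] -/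
theorem reflV_mul_GradOp : reflV N κ * GradOp N c = GradOp N c * reflS N κ := by
  refine matrix_eq_of_mulVec_eq fun l => ?_
  funext i; obtain ⟨x, μ⟩ := i
  rw [← Matrix.mulVec_mulVec, ← Matrix.mulVec_mulVec, GradOp_mulVec, sdiff_mulVec, reflS_mulVec, reflS_mulVec]
  by_cases h : μ = κ
  · subst h; rw [reflV_mulVec_same, GradOp_mulVec, sdiff_mulVec, sub_add_cancel, torRefl_add_unitVec_same]; ring
  · rw [reflV_mulVec_ne _ _ h, GradOp_mulVec, sdiff_mulVec, torRefl_add_unitVec_ne _ h]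

/-- `R⁰∂* = ∂*R¹`. [folklore] -/
theorem reflS_mul_GradOp_conjTranspose : reflS N κ * (GradOp N c)ᴴ = (GradOp N c)ᴴ * reflV N κ :=
  conjTranspose_comm_of_comm reflV_conjTranspose reflS_conjTranspose (reflV_mul_GradOp N κ c)

/-- **pointwise form of the vector Laplacian**: `(Σ_ν ∇_ν^*∇_ν u)(x, μ) = Σ_ν |c|²(2u(x,μ) − u(x+e_ν,μ) − u(x−e_ν,μ))`. [cite: Balaban1984PropagatorsI, (1.21) p.21] -/
theorem LapV_mulVec_apply (u : Tor N × Fin d → ℂ) (x : Tor N) (μ : Fin d) :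
    (LapV N c *ᵥ u) (x, μ) = ∑ ν, conj c * c * (2 * u (x, μ) - u (x + unitVec N ν, μ) - u (x - unitVec N ν, μ)) := by
  have hsh : ∀ (ν : Fin d) (w : Tor N × Fin d → ℂ) (i : Tor N × Fin d), ((shiftM N ν)ᴴ *ᵥ w) i = w (i.1 - unitVec N ν, i.2) := by
    intro ν w i
    simp only [Matrix.mulVec, dotProduct, Matrix.conjTranspose_apply]
    rw [Finset.sum_eq_single (i.1 - unitVec N ν, i.2)]
    · simp [shiftM]
    · intro j _ hj
      have hij : ¬ i = (j.1 + unitVec N ν, j.2) := by rintro rfl; exact hj (by simp)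
      simp [shiftM, hij]
    · intro h; exact absurd (Finset.mem_univ _) h
  simp only [LapV, Matrix.sum_mulVec, Finset.sum_apply]
  refine Finset.sum_congr rfl fun ν _ => ?_
  rw [← Matrix.mulVec_mulVec]
  simp only [fdiff, Matrix.conjTranspose_smul, Matrix.conjTranspose_sub, Matrix.conjTranspose_one, Matrix.smul_mulVec, Matrix.sub_mulVec,
    Matrix.one_mulVec, Pi.smul_apply, Pi.sub_apply, smul_eq_mul, hsh, B5Action121.shiftM_mulVec, Complex.star_def, sub_add_cancel]
  ring

/-- `R¹Δ = ΔR¹` for the vector Laplacian `Σ_ν ∇_ν^*∇_ν` (componentwise; the `κ`-twist is a translation and a sign, both commuting with `Δ`). [cite: Balaban1984PropagatorsI, (1.21) p.21, (1.90) p.33] -/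
theorem reflV_mul_LapV : reflV N κ * LapV N c = LapV N c * reflV N κ := by
  refine matrix_eq_of_mulVec_eq fun u => ?_
  funext i; obtain ⟨x, μ⟩ := i
  rw [← Matrix.mulVec_mulVec, ← Matrix.mulVec_mulVec]
  by_cases h : μ = κ
  · subst h
    rw [reflV_mulVec_same, LapV_mulVec_apply, LapV_mulVec_apply, ← Finset.sum_neg_distrib]
    refine Finset.sum_congr rfl fun ν _ => ?_
    rw [reflV_mulVec_same, reflV_mulVec_same, reflV_mulVec_same]
    by_cases hν : ν = μ
    · subst hν; rw [torRefl_add_unitVec_same, torRefl_sub_unitVec_same]; ring_nf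
    · rw [torRefl_add_unitVec_ne _ hν, torRefl_sub_unitVec_ne _ hν]; ring_nf
  · rw [reflV_mulVec_ne _ _ h, LapV_mulVec_apply, LapV_mulVec_apply]
    refine Finset.sum_congr rfl fun ν _ => ?_
    rw [reflV_mulVec_ne _ _ h, reflV_mulVec_ne _ _ h, reflV_mulVec_ne _ _ h]
    by_cases hν : ν = κ
    · subst hν; rw [torRefl_add_unitVec_same, torRefl_sub_unitVec_same]; ring
    · rw [torRefl_add_unitVec_ne _ hν, torRefl_sub_unitVec_ne _ hν]

/-- `R⁰Π₀ = Π₀R⁰` for the projection onto the constants (`c ≠ 0`). [folklore] -/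
theorem reflS_mul_Pker (hc : c ≠ 0) : reflS N κ * Pker N c = Pker N c * reflS N κ := by
  refine matrix_eq_of_mulVec_eq fun f => ?_
  rw [← Matrix.mulVec_mulVec, ← Matrix.mulVec_mulVec]
  have h1 : reflS N κ *ᵥ (Pker N c *ᵥ f) = Pker N c *ᵥ f := by
    funext x; rw [reflS_mulVec, Pker_const N hc f (torRefl N κ x), ← Pker_const N hc f x]
  have h2 : Pker N c *ᵥ (reflS N κ *ᵥ f - f) = 0 := by
    refine Pker_orth N hc _ ?_
    simp only [Pi.sub_apply, Finset.sum_sub_distrib, reflS_mulVec]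
    rw [sum_torRefl, sub_self]
  rw [h1, eq_comm, ← sub_eq_zero, ← Matrix.mulVec_sub, h2]

/-- ★ **ANYTHING COMMUTING WITH `Δ` AND `Π₀` COMMUTES WITH THE PSEUDO-INVERSE `Δ⁻¹`** — from the algebra `Δ⁻¹Δ + Π₀ = 1`, `ΔΔ⁻¹ = 1 − Π₀`, `Π₀Δ⁻¹ = 0 = Δ⁻¹Π₀` alone
(no Fourier transform; reused for translations in the sequel). [folklore] -/
theorem comm_LapSinv_of_comm {R : Matrix (Tor N) (Tor N) ℂ} (hL : R * LapS N c = LapS N c * R) (hP : R * Pker N c = Pker N c * R) :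
    R * LapSinv N c = LapSinv N c * R := by
  have h1 : LapSinv N c * LapS N c + Pker N c = 1 := by rw [LapSinv_mul_LapS]; abel
  calc R * LapSinv N c = (LapSinv N c * LapS N c + Pker N c) * (R * LapSinv N c) := by rw [h1, Matrix.one_mul]
    _ = LapSinv N c * (LapS N c * R) * LapSinv N c + Pker N c * R * LapSinv N c := by
        simp only [Matrix.add_mul, Matrix.mul_assoc]
    _ = LapSinv N c * (R * LapS N c) * LapSinv N c + R * Pker N c * LapSinv N c := by rw [hL, hP]
    _ = LapSinv N c * R * (LapS N c * LapSinv N c) + R * (Pker N c * LapSinv N c) := by simp only [Matrix.mul_assoc]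
    _ = LapSinv N c * R := by
        rw [LapS_mul_LapSinv, Pker_mul_LapSinv, Matrix.mul_zero, add_zero, Matrix.mul_sub, Matrix.mul_one, Matrix.mul_assoc, hP,
          ← Matrix.mul_assoc, LapSinv_mul_Pker, Matrix.zero_mul, sub_zero]

/-- `R⁰Δ⁻¹ = Δ⁻¹R⁰` for the pseudo-inverse of the scalar Laplacian. [folklore] -/
theorem reflS_mul_LapSinv (hc : c ≠ 0) : reflS N κ * LapSinv N c = LapSinv N c * reflS N κ :=
  comm_LapSinv_of_comm N c (reflS_mul_LapS N κ c) (reflS_mul_Pker N κ c hc)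

end Scalar

section Averages

variable (n : ℕ) [NeZero n] (M : Fin d → ℕ) [∀ μ, NeZero (M μ)] (κ : Fin d)

/-- `R̃⁰Q′ = Q′R⁰` for the scalar block average (1.20) (blocks go to blocks). [cite: Balaban1984PropagatorsI, (1.20) p.20] -/
theorem reflS_mul_QsOp : reflS M κ * QsOp n M = QsOp n M * reflS (fine n M) κ := by
  refine matrix_eq_of_mulVec_eq fun f => ?_
  funext y
  rw [← Matrix.mulVec_mulVec, ← Matrix.mulVec_mulVec, reflS_mulVec, QsOp_mulVec, QsOp_mulVec]
  congr 1
  rw [← Function.Bijective.sum_comp (flipIdx_bijective (n := n) (κ := κ))]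
  refine Finset.sum_congr rfl fun j _ => ?_
  rw [reflS_mulVec, torRefl_bpt]

omit [NeZero n] [∀ μ, NeZero (M μ)] in
/-- the `κ`-coordinate bookkeeping of the vector average: `n·σ̃y + flip j − (t+1)e_κ = n·(σ̃y − ẽ_κ) + flip j + (n−1−t)e_κ`. [folklore] -/
theorem bpt_torRefl_sub_tstep (y : Tor M) (j : Fin d → Fin n) (t : Fin n) :
    bpt n M (torRefl M κ y) j - tstep (fine n M) κ ((t : ℕ) + 1) = bpt n M (torRefl M κ y - unitVec M κ) j + tstep (fine n M) κ ((Fin.rev t : Fin n) : ℕ) := by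
  rw [bpt, bpt]
  have hu : up n M (torRefl M κ y - unitVec M κ) = up n M (torRefl M κ y) - tstep (fine n M) κ n := by
    rw [sub_eq_add_neg, B5Block118.up_add]
    have : up n M (-unitVec M κ) = -up n M (unitVec M κ) := by funext ν; simp [up]
    rw [this, B5Block118.up_unitVec, ← sub_eq_add_neg]
  rw [hu]
  funext ν
  simp only [Pi.add_apply, Pi.sub_apply, tstep]
  by_cases h : ν = κ
  · subst h; simp only [if_true]; rw [cast_rev]; push_cast; ring
  · simp [h]

/-- ★★ **`R̃¹Q = QR¹` FOR BAŁABAN's VECTOR AVERAGE (1.18)** — the line-count stencil is mirror symmetric: reflected fine `κ`-bonds with their start point one step lower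
enumerate the stencil of the reflected coarse bond after `j_κ ↦ n−1−j_κ`, `t ↦ n−1−t`. [cite: Balaban1984PropagatorsI, (1.18) p.20] -/
theorem reflV_mul_QvOp : reflV M κ * QvOp n M = QvOp n M * reflV (fine n M) κ := by
  refine matrix_eq_of_mulVec_eq fun A => ?_
  funext i; obtain ⟨y, μ⟩ := i
  rw [← Matrix.mulVec_mulVec, ← Matrix.mulVec_mulVec]
  by_cases h : μ = κ
  · subst h
    rw [reflV_mulVec_same, QvOp_mulVec, QvOp_mulVec, ← mul_neg, ← Finset.sum_neg_distrib]
    congr 1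
    rw [← Function.Bijective.sum_comp (flipIdx_bijective (n := n) (κ := μ))]
    refine Finset.sum_congr rfl fun j _ => ?_
    simp only [lineSum, reflV_mulVec_same, ← Finset.sum_neg_distrib]
    rw [← Function.Bijective.sum_comp (Function.Involutive.bijective (Fin.rev_involutive (n := n)))]
    refine Finset.sum_congr rfl fun t _ => ?_
    rw [torRefl_add, torNeg_tstep_same, torRefl_bpt, ← sub_eq_add_neg, sub_sub, ← tstep_succ, bpt_torRefl_sub_tstep]
  · rw [reflV_mulVec_ne _ _ h, QvOp_mulVec, QvOp_mulVec]
    congr 1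
    rw [← Function.Bijective.sum_comp (flipIdx_bijective (n := n) (κ := κ))]
    refine Finset.sum_congr rfl fun j _ => ?_
    simp only [lineSum, reflV_mulVec_ne _ _ h]
    refine Finset.sum_congr rfl fun t _ => ?_
    rw [torRefl_add, torNeg_tstep_ne h, torRefl_bpt]

/-- `R¹Q* = Q*R̃¹` for `Q* = n^d•Qᴴ`. [cite: Balaban1984PropagatorsI, (1.69) p.29] -/
theorem reflV_mul_QvAdj : reflV (fine n M) κ * QvAdj n M = QvAdj n M * reflV M κ := by
  rw [QvAdj, Matrix.mul_smul, Matrix.smul_mul]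
  congr 1
  exact conjTranspose_comm_of_comm reflV_conjTranspose reflV_conjTranspose (reflV_mul_QvOp n M κ)

/-- `R⁰Q′ᴴ = Q′ᴴR̃⁰`. [folklore] -/
theorem reflS_mul_QsOp_conjTranspose : reflS (fine n M) κ * (QsOp n M)ᴴ = (QsOp n M)ᴴ * reflS M κ :=
  conjTranspose_comm_of_comm reflS_conjTranspose reflS_conjTranspose (reflS_mul_QsOp n M κ)

variable (c : ℂ)

/-- `R̃⁰(Q′Δ⁻²Q′*) = (Q′Δ⁻²Q′*)R̃⁰`. [cite: Balaban1984PropagatorsI, Sect. C p.22] -/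
theorem reflS_mul_Mop (hc : c ≠ 0) : reflS M κ * Mop n M c = Mop n M c * reflS M κ := by
  simp only [Mop, ← Matrix.mul_assoc, reflS_mul_QsOp]
  rw [Matrix.mul_assoc (QsOp n M) (reflS _ κ), reflS_mul_LapSinv _ κ c hc, ← Matrix.mul_assoc, Matrix.mul_assoc (QsOp n M * LapSinv _ c) (reflS _ κ),
    reflS_mul_LapSinv _ κ c hc, ← Matrix.mul_assoc, Matrix.mul_assoc _ (reflS _ κ), reflS_mul_QsOp_conjTranspose, ← Matrix.mul_assoc]

/-- a permutation matrix commutes with the constant matrix. [folklore] -/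
theorem reflS_mul_Cavg : reflS M κ * Cavg M = Cavg M * reflS M κ := by
  ext x y
  rw [Matrix.mul_apply, Matrix.mul_apply]
  have h : ∀ z : Tor M, (y = torRefl M κ z) ↔ (z = torRefl M κ y) := fun z => by rw [eq_comm, torRefl_eq_iff]
  simp only [reflS, Cavg, ite_mul, one_mul, zero_mul, mul_ite, mul_one, mul_zero, Finset.sum_ite_eq', Finset.mem_univ, if_true]
  simp_rw [h]
  rw [Finset.sum_ite_eq', if_pos (Finset.mem_univ _)]

end Averages


section DeltaASect

variable (n : ℕ) [NeZero n] (M : Fin d → ℕ) [∀ μ, NeZero (M μ)] (κ : Fin d)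

/-- `R̃⁰K = KR̃⁰` for `K = Q′Δ⁻²Q′* + C`. [folklore] -/
theorem reflS_mul_Kmat (c : ℂ) (hc : c ≠ 0) : reflS M κ * Kmat n M c = Kmat n M c * reflS M κ := by
  rw [Kmat, Matrix.mul_add, Matrix.add_mul, reflS_mul_Mop n M κ c hc, reflS_mul_Cavg]

/-- `R̃⁰K⁻¹ = K⁻¹R̃⁰`. [folklore] -/
theorem reflS_mul_Minv (c : ℂ) (hc : c ≠ 0) : reflS M κ * Minv n M c = Minv n M c * reflS M κ :=
  mul_nonsing_inv_comm ((Matrix.isUnit_iff_isUnit_det _).mp (Kmat_isUnit n M c hc)) (reflS_mul_Kmat n M κ c hc)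

/-- `R⁰P = PR⁰` for the projection `P = Δ⁻¹Q′*(Q′Δ⁻²Q′*)⁻¹Q′Δ⁻¹` of (1.26)∕(1.70). [cite: Balaban1984PropagatorsI, (1.26) p.22, (1.70) p.30] -/
theorem reflS_mul_PcT (c : ℂ) (hc : c ≠ 0) : reflS (fine n M) κ * PcT n M c = PcT n M c * reflS (fine n M) κ := by
  show reflS (fine n M) κ * (LapSinv (fine n M) c * (QsOp n M)ᴴ * Minv n M c * QsOp n M * LapSinv (fine n M) c)
      = LapSinv (fine n M) c * (QsOp n M)ᴴ * Minv n M c * QsOp n M * LapSinv (fine n M) c * reflS (fine n M) κ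
  simp only [Matrix.mul_assoc]
  rw [← Matrix.mul_assoc (reflS _ κ), reflS_mul_LapSinv _ κ c hc, Matrix.mul_assoc, ← Matrix.mul_assoc (reflS _ κ), reflS_mul_QsOp_conjTranspose,
    Matrix.mul_assoc, ← Matrix.mul_assoc (reflS _ κ), reflS_mul_Minv n M κ c hc, Matrix.mul_assoc, ← Matrix.mul_assoc (reflS _ κ), reflS_mul_QsOp,
    Matrix.mul_assoc, reflS_mul_LapSinv _ κ c hc]

variable (a : ℝ)

/-- ★★ **`R¹Δ_a = Δ_aR¹`: BAŁABAN's LANDAU-GAUGE OPERATOR `Δ_a = Δ − ∂P∂* + aQ*Q` COMMUTES WITH THE BLOCK-FACE REFLECTIONS** (on the torus `T_η = Tor (fine n M)`, any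
`a`). [cite: Balaban1984PropagatorsI, (1.69) p.29, (1.73) p.30] -/
theorem reflV_mul_DeltaA : reflV (fine n M) κ * DeltaA n M a = DeltaA n M a * reflV (fine n M) κ := by
  have hc : (n : ℂ) ≠ 0 := Nat.cast_ne_zero.mpr (NeZero.ne n)
  have t2 : reflV (fine n M) κ * (GradOp (fine n M) (n : ℂ) * PcT n M (n : ℂ) * (GradOp (fine n M) (n : ℂ))ᴴ)
      = GradOp (fine n M) (n : ℂ) * PcT n M (n : ℂ) * (GradOp (fine n M) (n : ℂ))ᴴ * reflV (fine n M) κ := by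
    rw [← Matrix.mul_assoc, ← Matrix.mul_assoc, reflV_mul_GradOp, Matrix.mul_assoc (GradOp _ _) (reflS _ κ), reflS_mul_PcT n M κ _ hc, ← Matrix.mul_assoc,
      Matrix.mul_assoc _ (reflS _ κ), reflS_mul_GradOp_conjTranspose, ← Matrix.mul_assoc]
  have t3 : reflV (fine n M) κ * (QvAdj n M * QvOp n M) = QvAdj n M * QvOp n M * reflV (fine n M) κ := by
    rw [← Matrix.mul_assoc, reflV_mul_QvAdj, Matrix.mul_assoc, reflV_mul_QvOp, ← Matrix.mul_assoc]
  rw [DeltaA, B5Action121.Lap_eq_LapV, Matrix.mul_add, Matrix.mul_sub, Matrix.add_mul, Matrix.sub_mul, Matrix.mul_smul, Matrix.smul_mul,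
    reflV_mul_LapV, t2, t3]

/-- ★★ **`R¹G = GR¹` for `G = Δ_a⁻¹`** (`n ≥ 1`, `a > 0`). [cite: Balaban1984PropagatorsI, (1.71) p.30] -/
theorem reflV_mul_DeltaA_inv (hn : 1 ≤ n) (ha : 0 < a) : reflV (fine n M) κ * (DeltaA n M a)⁻¹ = (DeltaA n M a)⁻¹ * reflV (fine n M) κ :=
  mul_nonsing_inv_comm ((Matrix.isUnit_iff_isUnit_det _).mp (isUnit_DeltaA n hn M a ha)) (reflV_mul_DeltaA n M κ a)

/-- the same for the REAL matrices `DeltaAR = re Δ_a`, `GR = re Δ_a⁻¹`. [folklore] -/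
theorem reM_reflV_mul_DeltaAR : reM (reflV (fine n M) κ) * DeltaAR n M a = DeltaAR n M a * reM (reflV (fine n M) κ) := by
  rw [DeltaAR, ← IsReal.reM_mul isReal_reflV (isReal_DeltaA n M a), ← IsReal.reM_mul (isReal_DeltaA n M a) isReal_reflV, reflV_mul_DeltaA]

/-- `re R¹ · re Δ_a⁻¹ = re Δ_a⁻¹ · re R¹`. [folklore] -/
theorem reM_reflV_mul_GR (hn : 1 ≤ n) (ha : 0 < a) : reM (reflV (fine n M) κ) * GR n M a = GR n M a * reM (reflV (fine n M) κ) := by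
  rw [GR, ← IsReal.reM_mul isReal_reflV (B5RealFields.isReal_DeltaA_inv n M a), ← IsReal.reM_mul (B5RealFields.isReal_DeltaA_inv n M a) isReal_reflV,
    reflV_mul_DeltaA_inv n M κ a hn ha]

end DeltaASect

/-! ## §4 The reflections as real linear maps on real 1-forms; `R_κ ∘ Δ_a = Δ_a ∘ R_κ`, `R_κ ∘ G = G ∘ R_κ` for the operators of this lineage -/

section RealOps

variable (M : Fin (d + 1) → ℕ) [∀ μ, NeZero (M μ)] (n : ℕ) [NeZero n] (κ : Fin (d + 1))

/-- **THE BLOCK-FACE REFLECTION ON REAL 1-FORMS** of `T_η × {0,…,d}` (bond twist on the `κ`-component). [cite: Balaban1984PropagatorsI, (1.1) p.18 («A_{⟨x,x′⟩} = −A_{⟨x′,x⟩}»)] -/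
def reflVR : (Tor (fine n M) × Fin (d + 1) → ℝ) →ₗ[ℝ] (Tor (fine n M) × Fin (d + 1) → ℝ) := Matrix.mulVecLin (reM (reflV (fine n M) κ))

/-- the scalar reflection on real functions of a torus (used on the unit lattice `Tor M` and on `T_η`). [folklore] -/
def reflSR (N : Fin (d + 1) → ℕ) [∀ μ, NeZero (N μ)] : (Tor N → ℝ) →ₗ[ℝ] (Tor N → ℝ) := Matrix.mulVecLin (reM (reflS N κ))

variable {M n κ}

/-- `(R_κA)(x, μ)` on real 1-forms: the bond-twisted pull-back. [folklore] -/
theorem reflVR_apply (A : Tor (fine n M) × Fin (d + 1) → ℝ) (x : Tor (fine n M)) (μ : Fin (d + 1)) :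
    reflVR M n κ A (x, μ) = if μ = κ then -A (torRefl (fine n M) κ x - unitVec (fine n M) κ, κ) else A (torRefl (fine n M) κ x, μ) := by
  have h := congrFun (IsReal.cplx_mulVec (isReal_reflV (N := fine n M) (κ := κ)) A) (x, μ)
  rw [B5RealFields.cplx_apply, reflV_mulVec] at h
  rw [reflVR, Matrix.mulVecLin_apply]
  apply Complex.ofReal_injective
  rw [h]
  split_ifs <;> simp [B5RealFields.cplx_apply]

/-- `(R_κA)(x, κ) = −A(σx − e_κ, κ)`. [folklore] -/
theorem reflVR_apply_same (A : Tor (fine n M) × Fin (d + 1) → ℝ) (x : Tor (fine n M)) :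
    reflVR M n κ A (x, κ) = -A (torRefl (fine n M) κ x - unitVec (fine n M) κ, κ) := by rw [reflVR_apply, if_pos rfl]

/-- `(R_κA)(x, μ) = A(σx, μ)` for `μ ≠ κ`. [folklore] -/
theorem reflVR_apply_ne (A : Tor (fine n M) × Fin (d + 1) → ℝ) (x : Tor (fine n M)) {μ : Fin (d + 1)} (h : μ ≠ κ) :
    reflVR M n κ A (x, μ) = A (torRefl (fine n M) κ x, μ) := by rw [reflVR_apply, if_neg h]

/-- `(R⁰f)(x) = f(σx)` on real functions. [folklore] -/
theorem reflSR_apply {N : Fin (d + 1) → ℕ} [∀ μ, NeZero (N μ)] (f : Tor N → ℝ) (x : Tor N) : reflSR κ N f x = f (torRefl N κ x) := by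
  have h := congrFun (IsReal.cplx_mulVec (isReal_reflS (N := N) (κ := κ)) f) x
  rw [B5RealFields.cplx_apply, reflS_mulVec] at h
  rw [reflSR, Matrix.mulVecLin_apply]
  exact Complex.ofReal_injective (by rw [h, B5RealFields.cplx_apply])

/-- `R_κ ∘ R_κ = id` on real 1-forms. [folklore] -/
theorem reflVR_comp_reflVR : reflVR M n κ ∘ₗ reflVR M n κ = LinearMap.id := by
  refine LinearMap.ext fun A => funext fun i => ?_
  obtain ⟨x, μ⟩ := i
  rw [LinearMap.comp_apply, LinearMap.id_apply]
  by_cases h : μ = κ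
  · subst h; rw [reflVR_apply_same, reflVR_apply_same, torRefl_sub_unitVec_torRefl_sub, neg_neg]
  · rw [reflVR_apply_ne _ _ h, reflVR_apply_ne _ _ h, torRefl_torRefl]

/-- `R_κ(R_κA) = A`. [folklore] -/
theorem reflVR_reflVR (A : Tor (fine n M) × Fin (d + 1) → ℝ) : reflVR M n κ (reflVR M n κ A) = A := by
  have := congrArg (fun f => f A) (reflVR_comp_reflVR (M := M) (n := n) (κ := κ))
  simpa using this

/-- `R⁰(R⁰f) = f`. [folklore] -/
theorem reflSR_reflSR {N : Fin (d + 1) → ℕ} [∀ μ, NeZero (N μ)] (f : Tor N → ℝ) : reflSR κ N (reflSR κ N f) = f := by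
  funext x; rw [reflSR_apply, reflSR_apply, torRefl_torRefl]

variable (M n κ) (a : ℝ)

/-- ★★★ **`R_κ ∘ Δ_a = Δ_a ∘ R_κ` on real 1-forms** (`deltaOp M n a`). [cite: Balaban1984PropagatorsI, (1.69) p.29] -/
theorem reflVR_comp_deltaOp : reflVR M n κ ∘ₗ deltaOp M n a = deltaOp M n a ∘ₗ reflVR M n κ := by
  rw [reflVR, deltaOp, ← Matrix.mulVecLin_mul, ← Matrix.mulVecLin_mul, reM_reflV_mul_DeltaAR]

/-- ★★★ **`R_κ ∘ G = G ∘ R_κ` on real 1-forms** for Bałaban's `U ≡ 1` Landau-gauge propagator `G = gOp M n a = Δ_a⁻¹` (`n ≥ 1`, `a > 0`): the torus propagator commutes with every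
block-face reflection — the input of the Neumann-by-images cube propagator of [B6] (2.37). [cite: Balaban1984PropagatorsI, (1.71) p.30; Balaban1984PropagatorsII, (2.37) p.229] -/
theorem reflVR_comp_gOp (hn : 1 ≤ n) (ha : 0 < a) : reflVR M n κ ∘ₗ gOp M n a = gOp M n a ∘ₗ reflVR M n κ := by
  rw [reflVR, gOp, ← Matrix.mulVecLin_mul, ← Matrix.mulVecLin_mul, reM_reflV_mul_GR n M κ a hn ha]

/-- conjugation form: `R_κ ∘ G ∘ R_κ = G`. [folklore] -/
theorem reflVR_comp_gOp_comp_reflVR (hn : 1 ≤ n) (ha : 0 < a) : reflVR M n κ ∘ₗ gOp M n a ∘ₗ reflVR M n κ = gOp M n a := by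
  rw [← LinearMap.comp_assoc, reflVR_comp_gOp M n κ a hn ha, LinearMap.comp_assoc, reflVR_comp_reflVR, LinearMap.comp_id]

end RealOps

end Summit.QuantumFields.YangMills.BalabanUVNodes.N15.TwoGrid
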